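import Literature.Analysis.FluidPDE.ScalarFourierFamily
import Literature.Analysis.FluidPDE.NSFourierSynthesis
import Literature.Analysis.FunctionSpaces.TorusRieszFischerParam
import Mathlib.Analysis.Calculus.ContDiff.FiniteDimension
import HarnessLib

/-!
# Synthesis: joint smoothness of `(t, x) ↦ ∑ₖ W₀(t, k) e_k(x)` on the closed slab `[0, T] × T^d`

Analysis/FluidPDE proof file, third of the files discharging
`Literature.Analysis.FluidPDE.Torus.exists_unique_isClassicalScalarTransportForcedOn`
(objects in `ScalarFourierDefs`, lattice bookkeeping in `ScalarFourierFamily`). It is the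
Fourier-series twin of `NSFourierSynthesis` (there: Fourier integrals on `ℝ^ι`): for a
coefficient family `W₀, …, W_n` on `[0, T]` (`IsCoeffFamily T n W`) the synthesized field
`synth W (t, y) = ∑ₖ W₀(t, k) e_k(proj y)` is `C^n` **jointly** in `(t, y)` on the closed slab
`[0, T] × ℝ^d`, one-sided in `t` at the endpoints (`contDiffOn_synth`), with derivatives again
synthesized fields: `∂ₜ synth W = synth (W₁, …)`, `∂_h synth W = synth (2πi⟨k, h⟩ W)`
(`hasFDerivWithinAt_synth`, `fderivWithin_synth_apply`, `timeDerivWithin_torusSynth`); hence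
`Torus.torusSynth c` is jointly smooth on `[0, T] × T^d` when `c` starts families of every
order (`isSmoothSpaceTimeOn_torusSynth`). The series is differentiated termwise with Mathlib's
`hasFDerivAt_tsum_of_isPreconnected` on the open slab `(-1, T+1) × ℝ^d`, the coefficients being
extended off `[0, T]` by tangent lines (`FourierNS.icExtend`); the lifted characters are
`e_k(proj y) = 𝐞(⟨latticeVec k, y⟩)` (`mFourier_proj`), differentiated with
`Real.hasDerivAt_fourierChar`.

Also proved: the Fourier coefficients of an absolutely convergent Fourier series are its
coefficients (`mFourierCoeff_tsum_mul_mFourier`; exchange of sum and integral and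
orthonormality, Grafakos 2014, Prop. 3.2.7) and pointwise Fourier inversion for continuous
functions with absolutely summable coefficients (`tsum_mFourierCoeff_mul_mFourier`, Mathlib
`UnitAddTorus.hasSum_mFourier_series_apply_of_summable`; Grafakos 2014, §3.3.1).

## Mathlib search

`hasFDerivAt_tsum_of_isPreconnected`, `continuousOn_tsum`, `contDiffOn_succ_of_fderiv_apply`,
`contDiffOn_infty`, `ContinuousLinearMap.map_tsum`, `Real.hasDerivAt_fourierChar`,
`fourier_coe_apply`, `integral_tsum_of_summable_integral_norm`,
`UnitAddTorus.hasSum_mFourier_series_apply_of_summable`. Mathlib has `x`-regularity criteria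
for series (`contDiff_tsum`) but no joint, one-sided-in-time statement on a closed slab.

## References

* L. Grafakos, *Classical Fourier Analysis*, 3rd ed., GTM 249 (2014), §3.1.1, Prop. 3.2.7,
  §3.3.1. [Grafakos2014]
* N. V. Krylov, *Lectures on Elliptic and Parabolic Equations in Hölder Spaces*, AMS 1996,
  Thm. 8.12.1, Ex. 8.12.4 (smoothness of solutions up to `t = 0`). [Krylov1996]
-/

noncomputable section

namespace Literature.Analysis.FluidPDE

namespace ScalarFourier

open MeasureTheory Real Set Filter UnitAddTorus Complex
open scoped Topology RealInnerProductSpace FourierTransform ContDiff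
open FourierNS (HasDecay clamp icExtend)
open Literature.Analysis.FunctionSpaces.Torus (proj latticeVec stLift)

variable {d : Type*} [Fintype d] [DecidableEq d]

/-! ### The lifted characters and their derivatives -/

section Char

/-- `⟪latticeVec k, y⟫ = ∑ᵢ kᵢ yᵢ`. [folklore] -/
theorem inner_latticeVec (k : d → ℤ) (y : EuclideanSpace ℝ d) :
    ⟪latticeVec k, y⟫ = ∑ i, (k i : ℝ) * y i := by
  simp [PiLp.inner_apply, FunctionSpaces.Torus.latticeVec_apply, mul_comm]

/-- **The lifted character is an exponential of a linear form**:
`e_k(proj y) = 𝐞(⟪latticeVec k, y⟫) = exp(2πi ∑ᵢ kᵢ yᵢ)` (Grafakos 2014, §3.1.1). [folklore] -/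
theorem mFourier_proj (k : d → ℤ) (y : EuclideanSpace ℝ d) :
    mFourier k (proj y) = (𝐞 (⟪latticeVec k, y⟫) : ℂ) := by
  simp only [mFourier, ContinuousMap.coe_mk, FunctionSpaces.Torus.proj_apply, fourier_coe_apply,
    Real.fourierChar_apply, ← Complex.exp_sum, inner_latticeVec]
  congr 1
  push_cast
  rw [Finset.mul_sum, Finset.sum_mul]
  refine Finset.sum_congr rfl fun i _ => ?_
  ring

/-- `‖latticeVec k‖ ≤ #d ‖k‖` (Euclidean length against the sup norm). [folklore] -/
theorem norm_latticeVec_le (k : d → ℤ) : ‖latticeVec k‖ ≤ Fintype.card d * ‖k‖ := by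
  unfold FunctionSpaces.Torus.latticeVec
  calc ‖∑ j, (k j : ℝ) • EuclideanSpace.single j (1 : ℝ)‖
      ≤ ∑ j, ‖(k j : ℝ) • EuclideanSpace.single j (1 : ℝ)‖ := norm_sum_le _ _
    _ ≤ ∑ _j : d, ‖k‖ := Finset.sum_le_sum fun j _ => by
        rw [norm_smul, EuclideanSpace.single, PiLp.norm_single, norm_one, mul_one,
          Real.norm_eq_abs]
        exact abs_apply_le_norm k j
    _ = Fintype.card d * ‖k‖ := by simp

/-- Evaluation of `echarCLM`. [folklore] -/
theorem echarCLM_apply (k : d → ℤ) (y h : EuclideanSpace ℝ d) :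
    echarCLM k y h = 2 * π * I * mFourier k (proj y) * (⟪latticeVec k, h⟫ : ℂ) := by
  simp only [echarCLM, ContinuousLinearMap.comp_apply, innerSL_apply_apply,
    ContinuousLinearMap.smulRight_apply, one_apply_eq_self, Complex.real_smul]
  ring

/-- **The lifted character is differentiable** with derivative `echarCLM k y` (chain rule with
Mathlib `Real.hasDerivAt_fourierChar`). [folklore] -/
theorem hasFDerivAt_echar (k : d → ℤ) (y : EuclideanSpace ℝ d) :
    HasFDerivAt (fun y : EuclideanSpace ℝ d => (mFourier k (proj y) : ℂ)) (echarCLM k y) y := by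
  have h1 : HasFDerivAt (fun y : EuclideanSpace ℝ d => ⟪latticeVec k, y⟫)
      (innerSL ℝ (latticeVec k)) y := (innerSL ℝ (latticeVec k)).hasFDerivAt
  have h2 := (Real.hasDerivAt_fourierChar (⟪latticeVec k, y⟫)).hasFDerivAt.comp y h1
  have heq : (fun y : EuclideanSpace ℝ d => (mFourier k (proj y) : ℂ)) =
      fun y => (𝐞 (⟪latticeVec k, y⟫) : ℂ) := funext fun y => mFourier_proj k y
  rw [heq]
  refine h2.congr_fderiv (ContinuousLinearMap.ext fun h => ?_)
  simp [echarCLM, ContinuousLinearMap.toSpanSingleton_apply, mFourier_proj]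

/-- Norm bound `‖echarCLM k y h‖ ≤ 2π ‖latticeVec k‖ ‖h‖`. [folklore] -/
theorem norm_echarCLM_apply_le (k : d → ℤ) (y h : EuclideanSpace ℝ d) :
    ‖echarCLM k y h‖ ≤ 2 * π * ‖latticeVec k‖ * ‖h‖ := by
  rw [echarCLM_apply]
  simp only [norm_mul, Complex.norm_two, Complex.norm_real, Complex.norm_I, mul_one,
    FunctionSpaces.Torus.norm_mFourier_apply, Real.norm_eq_abs, abs_of_pos Real.pi_pos]
  have := abs_real_inner_le_norm (latticeVec k) h
  have hπ := Real.pi_pos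
  nlinarith [norm_nonneg (latticeVec k), norm_nonneg h]

/-- Evaluation of `synthCLM`. [folklore] -/
theorem synthCLM_apply (W W' : ℂ) (k : d → ℤ) (y : EuclideanSpace ℝ d) (z : ℝ × EuclideanSpace ℝ d) :
    synthCLM W W' k y z = (z.1 : ℂ) * (mFourier k (proj y) * W') + W * echarCLM k y z.2 := by
  simp [synthCLM, Complex.real_smul, smul_eq_mul]

/-- Operator-norm bound for `synthCLM`. [folklore] -/
theorem norm_synthCLM_le (W W' : ℂ) (k : d → ℤ) (y : EuclideanSpace ℝ d) :
    ‖synthCLM W W' k y‖ ≤ ‖W'‖ + 2 * π * ‖latticeVec k‖ * ‖W‖ := by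
  refine ContinuousLinearMap.opNorm_le_bound _ (by positivity) fun z => ?_
  rw [synthCLM_apply]
  have h1 : ‖(z.1 : ℂ) * (mFourier k (proj y) * W')‖ ≤ ‖W'‖ * ‖z‖ := by
    rw [norm_mul, norm_mul, FunctionSpaces.Torus.norm_mFourier_apply, one_mul, Complex.norm_real,
      mul_comm]
    exact mul_le_mul_of_nonneg_left (norm_fst_le z) (norm_nonneg _)
  have h2 : ‖W * echarCLM k y z.2‖ ≤ 2 * π * ‖latticeVec k‖ * ‖W‖ * ‖z‖ := by
    rw [norm_mul]
    calc ‖W‖ * ‖echarCLM k y z.2‖ ≤ ‖W‖ * (2 * π * ‖latticeVec k‖ * ‖z.2‖) :=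
          mul_le_mul_of_nonneg_left (norm_echarCLM_apply_le k y z.2) (norm_nonneg _)
      _ ≤ ‖W‖ * (2 * π * ‖latticeVec k‖ * ‖z‖) := by gcongr; exact norm_snd_le z
      _ = 2 * π * ‖latticeVec k‖ * ‖W‖ * ‖z‖ := by ring
  calc ‖(z.1 : ℂ) * (mFourier k (proj y) * W') + W * echarCLM k y z.2‖
      ≤ ‖(z.1 : ℂ) * (mFourier k (proj y) * W')‖ + ‖W * echarCLM k y z.2‖ := norm_add_le _ _
    _ ≤ ‖W'‖ * ‖z‖ + 2 * π * ‖latticeVec k‖ * ‖W‖ * ‖z‖ := add_le_add h1 h2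
    _ = (‖W'‖ + 2 * π * ‖latticeVec k‖ * ‖W‖) * ‖z‖ := by ring

/-- Product rule for one term `z ↦ c(z.1) e_k(proj z.2)` with `c` differentiable in `t`. [folklore] -/
theorem hasFDerivAt_echar_mul {c : ℝ → ℂ} {c' : ℂ} (k : d → ℤ) (z : ℝ × EuclideanSpace ℝ d)
    (hc : HasDerivAt c c' z.1) :
    HasFDerivAt (fun zz : ℝ × EuclideanSpace ℝ d => c zz.1 * mFourier k (proj zz.2))
      (synthCLM (c z.1) c' k z.2) z := by
  have he : HasFDerivAt (fun zz : ℝ × EuclideanSpace ℝ d => (mFourier k (proj zz.2) : ℂ))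
      ((echarCLM k z.2).comp (ContinuousLinearMap.snd ℝ ℝ (EuclideanSpace ℝ d))) z :=
    (hasFDerivAt_echar k z.2).comp z hasFDerivAt_snd
  have hd : HasFDerivAt (fun zz : ℝ × EuclideanSpace ℝ d => c zz.1)
      ((ContinuousLinearMap.smulRight (1 : ℝ →L[ℝ] ℝ) c').comp
        (ContinuousLinearMap.fst ℝ ℝ (EuclideanSpace ℝ d))) z :=
    hc.hasFDerivAt.comp z hasFDerivAt_fst
  have h := hd.mul he
  refine h.congr_fderiv ?_
  ext y <;> simp [synthCLM_apply, smul_eq_mul]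

/-- `|t - clamp T t| ≤ 1` on the open time interval `(-1, T + 1)`. [folklore] -/
theorem abs_sub_clamp_le_one {T t : ℝ} (hT : 0 ≤ T) (ht : t ∈ Ioo (-1) (T + 1)) :
    |t - clamp T t| ≤ 1 := by
  rcases le_total t 0 with h0 | h0
  · have : clamp T t = 0 := by simp [FourierNS.clamp, min_eq_left (h0.trans hT), max_eq_left h0]
    rw [this, sub_zero, abs_of_nonpos h0]
    linarith [ht.1]
  rcases le_total t T with h1 | h1
  · rw [FourierNS.clamp_of_mem ⟨h0, h1⟩, sub_self, abs_zero]; exact zero_le_one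
  · have : clamp T t = T := by simp [FourierNS.clamp, min_eq_right h1, max_eq_right hT]
    rw [this, abs_of_nonneg (by linarith)]
    linarith [ht.2]

end Char

/-! ### The synthesized field on the slab -/

section Synth

variable {T : ℝ} {n : ℕ} {W : ℕ → ℝ → (d → ℤ) → ℂ}

omit [DecidableEq d] in
/-- Norm of one term: `‖c(k) e_k(x)‖ = ‖c(k)‖`. [folklore] -/
theorem norm_mul_mFourier (c : ℂ) (k : d → ℤ) (x : UnitAddTorus d) : ‖c * mFourier k x‖ = ‖c‖ := by
  rw [norm_mul, FunctionSpaces.Torus.norm_mFourier_apply, mul_one]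

omit [DecidableEq d] in
/-- The Fourier series of a sequence with decay of the summable order converges absolutely. [folklore] -/
theorem summable_mul_mFourier {K : ℕ} {C : ℝ} {c : (d → ℤ) → ℂ} (hK : latOrder d ≤ K)
    (hc : HasDecay K C c) (x : UnitAddTorus d) : Summable fun k => c k * mFourier k x :=
  Summable.of_norm_bounded ((summable_latWeight (d := d)).mul_left C) fun k => by
    rw [norm_mul_mFourier]; exact (hc.of_le hK) k

omit [DecidableEq d] in
/-- **Joint continuity** of the synthesized field on the closed slab `[0, T] × ℝ^d` for a
family of order `0` (uniformly convergent series of continuous terms, Mathlib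
`continuousOn_tsum`). [folklore] -/
theorem continuousOn_synth (hW : IsCoeffFamily T n W) :
    ContinuousOn (synth W) (Icc 0 T ×ˢ univ) := by
  obtain ⟨C, -, hC⟩ := hW.decay_nonneg (Nat.zero_le _) (latOrder d)
  have hsynth : synth W = fun z => ∑' k, W 0 z.1 k * mFourier k (proj z.2) := funext (synth_apply W)
  rw [hsynth]
  refine continuousOn_tsum (fun k => ?_) ((summable_latWeight (d := d)).mul_left C)
    fun k z hz => ?_
  · have h1 : ContinuousOn (fun z : ℝ × EuclideanSpace ℝ d => W 0 z.1 k) (Icc 0 T ×ˢ univ) :=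
      (hW.cont 0 (Nat.zero_le _) k).comp continuous_fst.continuousOn fun z hz => hz.1
    have h2 : Continuous fun z : ℝ × EuclideanSpace ℝ d => (mFourier k (proj z.2) : ℂ) :=
      (mFourier k).continuous.comp (FunctionSpaces.Torus.continuous_proj.comp continuous_snd)
    exact h1.mul h2.continuousOn
  · rw [norm_mul_mFourier]
    exact hC z.1 hz.1 k

/-- The directional-derivative family of a family is a family (symbol of linear growth
`‖2πi⟪latticeVec k, h⟫‖ ≤ 2π #d ‖h‖ (1 + ‖k‖)`). [folklore] -/
theorem IsCoeffFamily.dmulFamily (hW : IsCoeffFamily T n W) (h : EuclideanSpace ℝ d) :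
    IsCoeffFamily T n (dmulFamily h W) := by
  refine hW.symbol (σ := fun k => 2 * π * Complex.I * (⟪latticeVec k, h⟫ : ℂ)) (g := 1)
    (M := 2 * π * (Fintype.card d * ‖h‖)) (by positivity) fun k => ?_
  simp only [norm_mul, Complex.norm_two, Complex.norm_real, Complex.norm_I, mul_one,
    Real.norm_eq_abs, abs_of_pos Real.pi_pos, pow_one]
  have h1 := abs_real_inner_le_norm (latticeVec k) h
  have h2 := norm_latticeVec_le k
  have hπ := Real.pi_pos
  have hc : (0:ℝ) ≤ Fintype.card d := Nat.cast_nonneg _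
  calc 2 * π * |⟪latticeVec k, h⟫| ≤ 2 * π * (‖latticeVec k‖ * ‖h‖) := by gcongr
    _ ≤ 2 * π * (Fintype.card d * ‖k‖ * ‖h‖) := by gcongr
    _ ≤ 2 * π * (Fintype.card d * (1 + ‖k‖) * ‖h‖) := by gcongr; linarith [norm_nonneg k]
    _ = 2 * π * (Fintype.card d * ‖h‖) * (1 + ‖k‖) := by ring

omit [Fintype d] in
/-- `dmulFamily 0 W = 0`: no derivative in the zero direction. [folklore] -/
theorem synth_dmulFamily_zero [Fintype d] (W : ℕ → ℝ → (d → ℤ) → ℂ) (z : ℝ × EuclideanSpace ℝ d) :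
    synth (dmulFamily 0 W) z = 0 := by
  rw [synth_apply]
  simp [dmulFamily_apply]

-- the dominated-differentiation step elaborates many continuous-linear-map coercions
set_option maxHeartbeats 800000 in
/-- **The joint derivative within the slab.** For a family of order `≥ 1` and
`z = (t, y) ∈ [0, T] × ℝ^d`, the synthesized field has, within the slab, a Fréchet derivative
`L` with `L v = v.1 • synth (W₁, …) z + synth (dmulFamily v.2 W) z` (termwise differentiation
of the series of the tangent-line extensions in `t`, Mathlib
`hasFDerivAt_tsum_of_isPreconnected` on the open slab `(-1, T+1) × ℝ^d`; series twin of
`FourierNS.hasFDerivWithinAt_synth`). [folklore] -/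
theorem hasFDerivWithinAt_synth (hT : 0 < T) (hW : IsCoeffFamily T (n + 1) W)
    {z : ℝ × EuclideanSpace ℝ d} (hz : z ∈ Icc 0 T ×ˢ univ) :
    ∃ L : ℝ × EuclideanSpace ℝ d →L[ℝ] ℂ,
      HasFDerivWithinAt (synth W) L (Icc 0 T ×ˢ univ) z ∧
      ∀ v, L v = (v.1 : ℂ) * synth (fun i => W (i + 1)) z + synth (dmulFamily v.2 W) z := by
  set K₀ := latOrder d with hK₀def
  have ht₀ : z.1 ∈ Icc 0 T := hz.1
  have h0 : 0 ≤ n + 1 := Nat.zero_le _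
  have h1 : 1 ≤ n + 1 := by omega
  -- decay constants (order `K₀` and `K₀ + 1`) of `W₀`, `W₁` on `[0, T]`
  obtain ⟨C₀, hC₀0, hC₀⟩ := hW.decay_nonneg h0 K₀
  obtain ⟨C₀', hC₀'0, hC₀'⟩ := hW.decay_nonneg h0 (1 + K₀)
  obtain ⟨C₁, hC₁0, hC₁⟩ := hW.decay_nonneg h1 K₀
  obtain ⟨C₁', hC₁'0, hC₁'⟩ := hW.decay_nonneg h1 (1 + K₀)
  -- the extended coefficient and its time derivative
  set Wt : ℝ → (d → ℤ) → ℂ := fun t k => icExtend T (W 0 · k) (W 1 · k) t with hWt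
  set Wt' : ℝ → (d → ℤ) → ℂ := fun t k => W 1 (clamp T t) k with hWt'
  have hWt_deriv : ∀ k t, HasDerivAt (Wt · k) (Wt' t k) t := fun k t =>
    FourierNS.hasDerivAt_icExtend hT (fun s hs => by simpa using hW.deriv 0 (by omega) k s hs) t
  -- the terms and their derivatives
  set F : (d → ℤ) → ℝ × EuclideanSpace ℝ d → ℂ :=
    fun k zz => Wt zz.1 k * mFourier k (proj zz.2) with hF
  set F' : (d → ℤ) → ℝ × EuclideanSpace ℝ d → (ℝ × EuclideanSpace ℝ d →L[ℝ] ℂ) :=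
    fun k zz => synthCLM (Wt zz.1 k) (Wt' zz.1 k) k zz.2 with hF'
  have hF_diff : ∀ k zz, HasFDerivAt (F k) (F' k zz) zz := fun k zz =>
    hasFDerivAt_echar_mul k zz (hWt_deriv k zz.1)
  -- the open slab
  set O : Set (ℝ × EuclideanSpace ℝ d) := Ioo (-1) (T + 1) ×ˢ univ with hO
  have hO_open : IsOpen O := isOpen_Ioo.prod isOpen_univ
  have hO_conn : IsPreconnected O := ((convex_Ioo (-1 : ℝ) (T + 1)).prod convex_univ).isPreconnected
  have hzO : z ∈ O := ⟨⟨by linarith [ht₀.1], by linarith [ht₀.2]⟩, mem_univ _⟩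
  -- the dominating sequence on the open slab
  set u : (d → ℤ) → ℝ := fun k =>
    (C₁ + 2 * π * Fintype.card d * (C₀' + C₁')) * ((1 + ‖k‖) ^ K₀)⁻¹ with hu
  have hu_sum : Summable u := (summable_latWeight (d := d)).mul_left _
  have h_bound : ∀ k zz, zz ∈ O → ‖F' k zz‖ ≤ u k := by
    intro k zz hzz
    have hcl := FourierNS.clamp_mem_Icc hT.le zz.1
    have hdt : |zz.1 - clamp T zz.1| ≤ 1 := abs_sub_clamp_le_one hT.le hzz.1
    have hWt'_le : ‖Wt' zz.1 k‖ ≤ C₁ * ((1 + ‖k‖) ^ K₀)⁻¹ := hC₁ _ hcl k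
    have hWt_le : ‖k‖ * ‖Wt zz.1 k‖ ≤ (C₀' + C₁') * ((1 + ‖k‖) ^ K₀)⁻¹ := by
      have e1 : ‖Wt zz.1 k‖ ≤ ‖W 0 (clamp T zz.1) k‖ + ‖W 1 (clamp T zz.1) k‖ := by
        change ‖W 0 (clamp T zz.1) k + (zz.1 - clamp T zz.1) • W 1 (clamp T zz.1) k‖ ≤ _
        refine (norm_add_le _ _).trans (add_le_add le_rfl ?_)
        rw [norm_smul, Real.norm_eq_abs]
        exact mul_le_of_le_one_left (norm_nonneg _) hdt
      have e2 := (hC₀' _ hcl).pow_mul_norm_le (n := 1) (K := K₀) k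
      have e3 := (hC₁' _ hcl).pow_mul_norm_le (n := 1) (K := K₀) k
      rw [pow_one] at e2 e3
      calc ‖k‖ * ‖Wt zz.1 k‖ ≤ ‖k‖ * (‖W 0 (clamp T zz.1) k‖ + ‖W 1 (clamp T zz.1) k‖) :=
            mul_le_mul_of_nonneg_left e1 (norm_nonneg _)
        _ = ‖k‖ * ‖W 0 (clamp T zz.1) k‖ + ‖k‖ * ‖W 1 (clamp T zz.1) k‖ := by ring
        _ ≤ C₀' * ((1 + ‖k‖) ^ K₀)⁻¹ + C₁' * ((1 + ‖k‖) ^ K₀)⁻¹ := add_le_add e2 e3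
        _ = (C₀' + C₁') * ((1 + ‖k‖) ^ K₀)⁻¹ := by ring
    have hlat : ‖latticeVec k‖ * ‖Wt zz.1 k‖ ≤ Fintype.card d * ((C₀' + C₁') * ((1 + ‖k‖) ^ K₀)⁻¹) := by
      calc ‖latticeVec k‖ * ‖Wt zz.1 k‖ ≤ Fintype.card d * ‖k‖ * ‖Wt zz.1 k‖ :=
            mul_le_mul_of_nonneg_right (norm_latticeVec_le k) (norm_nonneg _)
        _ = Fintype.card d * (‖k‖ * ‖Wt zz.1 k‖) := by ring
        _ ≤ Fintype.card d * ((C₀' + C₁') * ((1 + ‖k‖) ^ K₀)⁻¹) :=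
            mul_le_mul_of_nonneg_left hWt_le (Nat.cast_nonneg _)
    calc ‖F' k zz‖ ≤ ‖Wt' zz.1 k‖ + 2 * π * ‖latticeVec k‖ * ‖Wt zz.1 k‖ := norm_synthCLM_le _ _ k zz.2
      _ = ‖Wt' zz.1 k‖ + 2 * π * (‖latticeVec k‖ * ‖Wt zz.1 k‖) := by ring
      _ ≤ C₁ * ((1 + ‖k‖) ^ K₀)⁻¹ + 2 * π * (Fintype.card d * ((C₀' + C₁') * ((1 + ‖k‖) ^ K₀)⁻¹)) := by
          gcongr
      _ = u k := by simp only [hu]; ring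
  -- summability at the base point
  have hFz : ∀ k, F k z = W 0 z.1 k * mFourier k (proj z.2) := fun k => by
    simp only [hF, hWt, FourierNS.icExtend_of_mem ht₀]
  have hF0 : Summable fun k => F k z := by
    refine (summable_mul_mFourier le_rfl (hC₀ z.1 ht₀) (proj z.2)).congr fun k => (hFz k).symm
  -- differentiate the series termwise
  have hmain := hasFDerivAt_tsum_of_isPreconnected hu_sum hO_open hO_conn
    (fun k zz _ => hF_diff k zz) h_bound hzO hF0 hzO
  have hF'_sum : Summable fun k => F' k z :=
    Summable.of_norm_bounded hu_sum fun k => h_bound k z hzO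
  refine ⟨∑' k, F' k z, ?_, fun v => ?_⟩
  · -- restrict to the slab, where `∑ F k zz = synth W zz`
    refine hmain.hasFDerivWithinAt.congr (fun zz hzz => ?_) ?_
    · rw [synth_apply]
      exact tsum_congr fun k => by
        simp only [hF, hWt, FourierNS.icExtend_of_mem (show zz.1 ∈ Icc 0 T from hzz.1)]
    · rw [synth_apply]
      exact tsum_congr fun k => by simp only [hF, hWt, FourierNS.icExtend_of_mem ht₀]
  · have happ := (ContinuousLinearMap.apply ℝ ℂ v).map_tsum hF'_sum
    simp only [ContinuousLinearMap.apply_apply] at happ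
    rw [happ, synth_apply, synth_apply]
    have hWt_z : ∀ k, Wt z.1 k = W 0 z.1 k := fun k => by simp only [hWt, FourierNS.icExtend_of_mem ht₀]
    have hWt'_z : ∀ k, Wt' z.1 k = W 1 z.1 k := fun k => by simp only [hWt', FourierNS.clamp_of_mem ht₀]
    have hs1 : Summable fun k => W (0 + 1) z.1 k * mFourier k (proj z.2) :=
      summable_mul_mFourier le_rfl (hC₁ z.1 ht₀) (proj z.2)
    obtain ⟨Cd, -, hCd⟩ := (hW.dmulFamily v.2).decay_nonneg h0 K₀
    have hs2 : Summable fun k => ScalarFourier.dmulFamily v.2 W 0 z.1 k * mFourier k (proj z.2) :=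
      summable_mul_mFourier le_rfl (hCd z.1 ht₀) (proj z.2)
    rw [← tsum_mul_left, ← (hs1.mul_left _).tsum_add hs2]
    refine tsum_congr fun k => ?_
    simp only [hF', synthCLM_apply, hWt_z, hWt'_z, echarCLM_apply, dmulFamily_apply, zero_add]
    ring

/-! ### Smoothness by induction on the order -/

/-- The directional derivatives within the slab are synthesized fields:
`fderivWithin (synth W) slab z v = v.1 • synth (W₁, …) z + synth (dmulFamily v.2 W) z`. [folklore] -/
theorem fderivWithin_synth_apply (hT : 0 < T) (hW : IsCoeffFamily T (n + 1) W)
    {z : ℝ × EuclideanSpace ℝ d} (hz : z ∈ Icc 0 T ×ˢ univ) (v : ℝ × EuclideanSpace ℝ d) :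
    fderivWithin ℝ (synth W) (Icc 0 T ×ˢ univ) z v =
      (v.1 : ℂ) * synth (fun i => W (i + 1)) z + synth (dmulFamily v.2 W) z := by
  obtain ⟨L, hL, hLv⟩ := hasFDerivWithinAt_synth hT hW hz
  rw [hL.fderivWithin (FourierNS.uniqueDiffOn_slab hT z hz), hLv]

/-- Differentiability of the synthesized field on the slab for families of order `≥ 1`. [folklore] -/
theorem differentiableOn_synth (hT : 0 < T) (hW : IsCoeffFamily T (n + 1) W) :
    DifferentiableOn ℝ (synth W) (Icc 0 T ×ˢ univ) := fun _ hz =>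
  (hasFDerivWithinAt_synth hT hW hz).choose_spec.1.differentiableWithinAt

/-- **Joint `C^n` smoothness of the synthesized field on the closed slab**, for every
coefficient family of order `n` (induction on `n` via Mathlib `contDiffOn_succ_of_fderiv_apply`;
the derivatives are synthesized fields of the shifted and symbol-multiplied families). [folklore] -/
theorem contDiffOn_synth (hT : 0 < T) :
    ∀ (n : ℕ) (W : ℕ → ℝ → (d → ℤ) → ℂ), IsCoeffFamily T n W →
      ContDiffOn ℝ n (synth W) (Icc 0 T ×ˢ univ) := by
  intro n
  induction n with
  | zero =>
    intro W hW
    rw [Nat.cast_zero, contDiffOn_zero]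
    exact continuousOn_synth hW
  | succ n ih =>
    intro W hW
    rw [Nat.cast_succ]
    refine contDiffOn_succ_of_fderiv_apply (differentiableOn_synth hT hW) (fun h => ?_) fun v => ?_
    · exact absurd h (by simp)
    · have h1 : ContDiffOn ℝ n (synth (fun i => W (i + 1))) (Icc 0 T ×ˢ univ) := ih _ hW.shift
      have h2 : ContDiffOn ℝ n (synth (dmulFamily v.2 W)) (Icc 0 T ×ˢ univ) :=
        ih _ ((hW.dmulFamily v.2).mono (Nat.le_succ n))
      have h3 : ContDiffOn ℝ n (fun z => (v.1 : ℂ) * synth (fun i => W (i + 1)) z +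
          synth (dmulFamily v.2 W) z) (Icc 0 T ×ˢ univ) := (contDiffOn_const.mul h1).add h2
      exact h3.congr fun z hz => fderivWithin_synth_apply hT hW hz v

/-- **`C^∞` smoothness**: if `c` is the zeroth member of a coefficient family of every order,
then `Torus.torusSynth c` is jointly smooth on `[0, T] × T^d`
(`Torus.IsSmoothSpaceTimeOn (Icc 0 T)`). [folklore] -/
theorem isSmoothSpaceTimeOn_torusSynth (hT : 0 < T) {c : ℝ → (d → ℤ) → ℂ}
    (hall : ∀ n : ℕ, ∃ W : ℕ → ℝ → (d → ℤ) → ℂ, W 0 = c ∧ IsCoeffFamily T n W) :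
    FunctionSpaces.Torus.IsSmoothSpaceTimeOn (Icc 0 T) (torusSynth c) := by
  change ContDiffOn ℝ ∞ (stLift (torusSynth c)) (Icc 0 T ×ˢ univ)
  rw [contDiffOn_infty]
  intro n
  obtain ⟨W, hW0, hW⟩ := hall n
  have h1 := contDiffOn_synth hT n W hW
  rwa [synth, hW0] at h1

/-- **The time derivative within `[0, T]`** of the synthesized field at a fixed point:
`∂ₜ ∑ₖ W₀(t,k) e_k(x) = ∑ₖ W₁(t,k) e_k(x)`, i.e.
`Torus.timeDerivWithin (Icc 0 T) (torusSynth W₀) t x = torusSynth W₁ t x`. [folklore] -/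
theorem timeDerivWithin_torusSynth (hT : 0 < T) (hW : IsCoeffFamily T (n + 1) W)
    {t : ℝ} (ht : t ∈ Icc 0 T) (x : UnitAddTorus d) :
    FunctionSpaces.Torus.timeDerivWithin (Icc 0 T) (torusSynth (W 0)) t x =
      torusSynth (W 1) t x := by
  obtain ⟨y, rfl⟩ := FunctionSpaces.Torus.proj_surjective x
  have hz : ((t, y) : ℝ × EuclideanSpace ℝ d) ∈ Icc 0 T ×ˢ (univ : Set (EuclideanSpace ℝ d)) :=
    mk_mem_prod ht (mem_univ y)
  obtain ⟨L, hL, hLv⟩ := hasFDerivWithinAt_synth hT hW hz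
  have hγ : HasDerivWithinAt (fun s : ℝ => ((s, y) : ℝ × EuclideanSpace ℝ d))
      ((1, 0) : ℝ × EuclideanSpace ℝ d) (Icc 0 T) t :=
    (hasDerivWithinAt_id t _).prodMk (hasDerivWithinAt_const _ _ _)
  have h := hL.comp_hasDerivWithinAt t hγ (fun s hs => mk_mem_prod hs (mem_univ _))
  have hval : L (1, 0) = synth (fun i => W (i + 1)) (t, y) := by
    rw [hLv]; simp [synth_dmulFamily_zero]
  rw [hval] at h
  exact h.derivWithin (uniqueDiffOn_Icc hT t ht)

end Synth

/-! ### Fourier coefficients of a synthesized series; Fourier inversion -/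

section Coefficients

omit [DecidableEq d]

/-- **The Fourier coefficients of an absolutely convergent Fourier series are its
coefficients**: `𝓕(∑ₖ cₖ e_k)(m) = c_m` (exchange of sum and integral, Mathlib
`integral_tsum_of_summable_integral_norm`, and orthonormality of the characters,
`Torus.integral_mFourier_neg_mul_mFourier`; Grafakos 2014, Prop. 3.2.7). [folklore] -/
theorem mFourierCoeff_tsum_mul_mFourier {c : (d → ℤ) → ℂ} (hc : Summable fun k => ‖c k‖)
    (m : d → ℤ) : mFourierCoeff (fun x => ∑' k, c k * mFourier k x) m = c m := by
  classical
  rw [FunctionSpaces.Torus.mFourierCoeff_eq_integral_volume]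
  have hint : ∀ k, Integrable (fun x : UnitAddTorus d => mFourier (-m) x • (c k * mFourier k x))
      volume := fun k =>
    ((mFourier (-m)).continuous.smul (continuous_const.mul (mFourier k).continuous)).integrable_unitAddTorus
  have hnorm : ∀ k, ∫ x : UnitAddTorus d, ‖mFourier (-m) x • (c k * mFourier k x)‖ = ‖c k‖ := by
    intro k
    have : ∀ x : UnitAddTorus d, ‖mFourier (-m) x • (c k * mFourier k x)‖ = ‖c k‖ := fun x => by
      rw [norm_smul, FunctionSpaces.Torus.norm_mFourier_apply, one_mul, norm_mul_mFourier]
    simp_rw [this]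
    simp
  have hsum : Summable fun k => ∫ x : UnitAddTorus d, ‖mFourier (-m) x • (c k * mFourier k x)‖ := by
    simp_rw [hnorm]; exact hc
  have hexch := integral_tsum_of_summable_integral_norm hint hsum
  have hpt : ∀ x : UnitAddTorus d, mFourier (-m) x • (∑' k, c k * mFourier k x) =
      ∑' k, mFourier (-m) x • (c k * mFourier k x) := fun x => by
    rw [smul_eq_mul, ← tsum_mul_left]
    rfl
  simp_rw [hpt]
  rw [← hexch]
  have hterm : ∀ k, ∫ x : UnitAddTorus d, mFourier (-m) x • (c k * mFourier k x) =
      if m = k then c k else 0 := by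
    intro k
    have : (fun x : UnitAddTorus d => mFourier (-m) x • (c k * mFourier k x)) =
        fun x => c k * (mFourier (-m) x * mFourier k x) := by
      funext x; rw [smul_eq_mul]; ring
    rw [this, integral_const_mul, FunctionSpaces.Torus.integral_mFourier_neg_mul_mFourier]
    split_ifs <;> simp
  simp_rw [hterm]
  have hite : (fun i => if m = i then c i else 0) = fun i => if i = m then c m else 0 := by
    funext i
    by_cases h : i = m
    · subst h; simp
    · rw [if_neg h, if_neg (Ne.symm h)]
  rw [hite, tsum_ite_eq]

/-- **Pointwise Fourier inversion** for a continuous function with absolutely summable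
coefficients: `∑ₖ 𝓕f(k) e_k(x) = f(x)` (Mathlib
`UnitAddTorus.hasSum_mFourier_series_apply_of_summable`; Grafakos 2014, Prop. 3.2.5 /
§3.3.1). [folklore] -/
theorem tsum_mFourierCoeff_mul_mFourier {f : UnitAddTorus d → ℂ} (hf : Continuous f)
    (hsum : Summable fun k => ‖mFourierCoeff f k‖) (x : UnitAddTorus d) :
    ∑' k, mFourierCoeff f k * mFourier k x = f x := by
  have h := hasSum_mFourier_series_apply_of_summable (f := ⟨f, hf⟩) hsum.of_norm x
  simpa using h.tsum_eq

end Coefficients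

end ScalarFourier

end Literature.Analysis.FluidPDE

end
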